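import Literature.IUT.HodgeArakelov.StableCurveAgreementOfSpecialFibreXuu
import HarnessLib

/-!
# B15b piece (3): [IUTchII] Def 2.3 (ii) at the genuine model — the cuspidal inertia groups of `Π_v` under the identification
# `Π̂_v ⥲ Π̂_{X̲̲_v}` are the conjugates of the inertia groups of the cusps of `X̲̲_v`

S. Mochizuki, *Inter-universal Teichmüller Theory II*, kurims manuscript (Dec. 2020), §2, Def 2.3 (ii) p. 68: «the cuspidal inertia groups of
`Π_⊆` may be obtained as the intersections with `Π_⊆` of those cuspidal inertia groups of `Π_⊇` that contain a finite index subgroup that lies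
inside `Π_⊆` [cf. [IUTchI], Corollary 2.5; [IUTchI], Remark 2.5.2]», for the natural inclusion `Π_v ⊆ Π^±_v` of Def 2.3 (i) p. 67
(`Π_v := Π^tp_{X̲̲_v}`, `Π^±_v := Π^tp_{X_v}` with `X_v` read `X̲_v`, F-L6t19g5-1); *Inter-universal Teichmüller Theory I* (May 2020), §2 p. 47
(«the cusps `x` … a representative inertia group `I_x ⊆ Δ^tp_X`»), Def 3.1 (e) p. 62 [cite: Mochizuki2012, II Def 2.3 (i)(ii) pp.67–68; I §2 p.47];
[SemiAnbd] §6 p. 71 («`I_x := D_x ∩ Δ^temp_X`»; covering theory: the points of `X_H` over `x` are the double cosets `H \ Π^temp_{X_K} / D_x`,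
`I_y = H ∩ g I_x g⁻¹`) [cite: MochizukiSemiAnbd2006, §6 p.71].  abc-iut cell, MERGE-MAP row **B15b** «common-model identification at `v ∈ 𝕍^bad`,
level `Π_v`» (abc-iut-L6-lead §F v1.19al «B15-XUU-TOWER»; holder abc-iut-L6-t19 gen 6), PIECE (3) after p437138 / p437742.  PROOF-ONLY (no `def`,
no `structure`, no `instance`); consumes BY NAME abc-iut-L6-t7's `StableCurveAgreement` (p412701) and tempered curves `X̲_v`, `X̲̲_v`
(`temperedCurveXuOfLevelData` p434191, `temperedCurveXuuOfLevelData` p434855), abc-iut-L3's `TemperedCurve.ofOpenSubgroup` (p432410: `PtOfOpen`,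
`repOfOpen`, `decompOfOpenAt`), abc-iut-L5's `StableCurveTemperedData.ofSpecialFibre`, abc-iut-w5-d132's agreement of record (p434636) and this
seat's `Π_v`-level identification (p437742).

THE POINT.  The cuspidal-inertia datum `Cu` OF RECORD on the genuine tower (p433029 / p434636) is GENERATED AT THE LEVEL `Π^±_v`: its
`Π^±_v`-cuspidal groups are the `Π^tp_{X̲_v}`-conjugates of the inertia groups `I_x` of the cusps of `X̲_v` (read through `eHat : Π̂^±_v ⥲ Π̂_{X̲_v}`),
and at every other level `Q` they are the intersections `I₀ ∩ Q` — print's recipe of Def 2.3 (ii).  At the level `Π_v` there is now a SECOND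
genuine description available: the cusps `y` of the curve `X̲̲_v` itself, with their inertia groups `I_y ⊆ Π^tp_{X̲̲_v}`, read through the
`Π_v`-level identification `eV : Π̂_v ⥲ Π̂_{X̲̲_v}` (p437742).  This file proves the two descriptions AGREE:

* **`PlusMinusTower.isCuspidalInertia_piV_iff_cuspsXuu`** — for ANY tower `W` over a Prop 2.1 output `T` of the print-level model, ANY `Cu`,
  `A : StableCurveAgreement W Cu Du` (`Du` = the [IUTchI] §2 datum of `X̲_v`) with `A.eHat ∘ emb = toHat ∘ plainIso` and the levels clause, and
  ANY `eV : Π̂_v ⥲ Π̂_{X̲̲_v}` (`Duu` = the datum of `X̲̲_v`) with `eV ∘ emb ∘ incl = toHat ∘ refIso`: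
  `Cu.IsCuspidalInertia Π_v I ↔ I ≤ Π_v ∧ ∃ (y : cusp of X̲̲_v) (s ∈ Π^tp_{X̲̲_v}), eV(I) = toHat(s · I_y · s⁻¹)` — i.e. the `inertia_iff`
  clause of an agreement AT LEVEL `Π_v` holds for the SAME datum `Cu`;
* (sibling file `StableCurveAgreementOfPiCHatPackage.lean`: the packaged instance `exists_agreements_ofPiCHat_with_piV_dictionary` at the tower of
  record `ofPiCHat` — `∃ Cu A eV` with the p434636 clauses (level `Π^±_v`), the p437742 clauses (level `Π_v`) and the dictionary above);
* bookkeeping lemmas `StableCurveAgreement.emb_mem_iff_of_map_eq` / `emb_incl_mem_iff_of_map_eq` (membership in a transported family),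
  `StableCurveAgreement.map_subgroupOf_pmHat_eq_of_iff` / `map_subgroupOf_hat_eq_of_iff` (constructors of the transport equations), and
  `mem_conj_inertiaTp_ofSpecialFibre_iff` (`w ∈ s I_y s⁻¹ ↔ s⁻¹ w s ∈ D_y ∧ aug w = 1` at `ofSpecialFibre`).

PROOF = covering-theory bookkeeping: both families of subgroups of `Π_v` are `{Π^tp_{X̲̲_v} ∩ k I_x k⁻¹ : x a cusp of X_v, k ∈ Π^tp_{X_v}}`
(the chosen double-coset representatives differ from `k` by `h k δ` with `h` in the open subgroup and `δ ∈ D_x ⊇ I_x`, `DoubleCoset.mk_out_eq_mul`).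
NOT used and NOT proved here: total ramification of `X̲̲_v → X̲_v` at the cusps (Rmk 2.1.1 (i); it is what makes each cusp of `X̲_v` carry exactly
one cusp of `X̲̲_v`, Rmk 2.3.1 «`I ∩ Π_⊆ = I^l`»).  HONEST LABEL: genuine on both sides modulo the binders (the towers / agreements / identifications
are quantified; the packaged instance carries L02 `hZ`, `hN`, `d`, the special-fibre DATA of `X̲_v` and of `X̲̲_v`).  Nothing of the series is
asserted; consistency ≠ endorsement; no side taken on [IUTchIII] Cor 3.12; constructed ≠ the paper's reconstruction algorithms.
-/

noncomputable section

namespace Literature.IUT.HodgeArakelov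

open Literature.AnabelianGeometry.EtaleTheta Literature.AnabelianGeometry.SemiGraphs Literature.IUT.HodgeTheaters
open scoped Pointwise

universe u

namespace PlusMinusTower

/-! ## Generic bookkeeping: membership in a transported family, at the levels `Π^±_v` and `Π_v` -/

section Generic

variable {S : BadPlaceSetting.{u}} {P : TopGroup.{u}} {T : TemperedCoverings S P}

/-- **IUTchII:Def2.3(ii)** (kurims p.68) At the level `Π^±_v`: if the agreement `A` carries `I₀ ∩ Π̂^±_v` onto `ιX(K)` and `A.eHat ∘ emb = ιX ∘ φ`,
then `emb w ∈ I₀ ↔ φ w ∈ K` (`ιX`, `eHat` injective).  Bookkeeping. [claim: Mochizuki2012, status: disputed] -/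
theorem StableCurveAgreement.emb_mem_iff_of_map_eq {W : PlusMinusTower T} {Cu : CuspidalInertiaData W}
    {D : StableCurveTemperedData.{u}} (A : StableCurveAgreement W Cu D) (φ : T.Xplain → D.PiTp)
    (hA : ∀ w : T.Xplain, A.eHat ⟨W.emb w, W.emb_le_pmHat ⟨w, rfl⟩⟩ = D.ιX (φ w))
    {I₀ : Subgroup W.Corhat} {K : Subgroup D.PiTp}
    (hEq : (I₀.subgroupOf W.pmHat).map A.eHat.toMonoidHom = K.map D.ιX) (w : T.Xplain) :
    W.emb w ∈ I₀ ↔ φ w ∈ K := by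
  constructor
  · intro hw
    have h1 : A.eHat ⟨W.emb w, W.emb_le_pmHat ⟨w, rfl⟩⟩ ∈ (I₀.subgroupOf W.pmHat).map A.eHat.toMonoidHom :=
      ⟨⟨W.emb w, W.emb_le_pmHat ⟨w, rfl⟩⟩, Subgroup.mem_subgroupOf.mpr hw, rfl⟩
    rw [hEq, hA] at h1
    obtain ⟨k, hk, hkw⟩ := h1
    rwa [← D.ιX_injective hkw]
  · intro hw
    have h1 : D.ιX (φ w) ∈ K.map D.ιX := ⟨φ w, hw, rfl⟩
    rw [← hEq, ← hA] at h1
    obtain ⟨g, hg, hge⟩ := h1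
    have hg' : g = ⟨W.emb w, W.emb_le_pmHat ⟨w, rfl⟩⟩ := A.eHat.injective hge
    rw [hg'] at hg
    exact Subgroup.mem_subgroupOf.mp hg

/-- **IUTchII:Def2.3(ii)** (kurims p.68) At the level `Π_v`: if `eV` carries `I ∩ Π̂_v` onto `ιX(K)` and `eV ∘ emb ∘ incl = ιX ∘ ψ`, then
`emb (incl z) ∈ I ↔ ψ z ∈ K`.  Bookkeeping. [claim: Mochizuki2012, status: disputed] -/
theorem emb_incl_mem_iff_of_map_eq {W : PlusMinusTower T} {D : StableCurveTemperedData.{u}} (eV : W.hat ≃* D.PiHat)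
    (ψ : P → D.PiTp) (hV : ∀ z : P, eV ⟨W.emb (T.incl z), W.embP_le_hat ⟨z, rfl⟩⟩ = D.ιX (ψ z))
    {I : Subgroup W.Corhat} {K : Subgroup D.PiTp}
    (hEq : (I.subgroupOf W.hat).map eV.toMonoidHom = K.map D.ιX) (z : P) :
    W.emb (T.incl z) ∈ I ↔ ψ z ∈ K := by
  constructor
  · intro hz
    have h1 : eV ⟨W.emb (T.incl z), W.embP_le_hat ⟨z, rfl⟩⟩ ∈ (I.subgroupOf W.hat).map eV.toMonoidHom :=
      ⟨⟨W.emb (T.incl z), W.embP_le_hat ⟨z, rfl⟩⟩, Subgroup.mem_subgroupOf.mpr hz, rfl⟩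
    rw [hEq, hV] at h1
    obtain ⟨k, hk, hkz⟩ := h1
    rwa [← D.ιX_injective hkz]
  · intro hz
    have h1 : D.ιX (ψ z) ∈ K.map D.ιX := ⟨ψ z, hz, rfl⟩
    rw [← hEq, ← hV] at h1
    obtain ⟨g, hg, hge⟩ := h1
    have hg' : g = ⟨W.emb (T.incl z), W.embP_le_hat ⟨z, rfl⟩⟩ := eV.injective hge
    rw [hg'] at hg
    exact Subgroup.mem_subgroupOf.mp hg

/-- **IUTchII:Def2.3(ii)** (kurims p.68) Constructor at the level `Π^±_v`: a subgroup `I₀ ≤ Π^±_v` whose `emb`-members are exactly the `w` with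
`φ w ∈ K` (`φ` a bijection, `A.eHat ∘ emb = ιX ∘ φ`) is carried by `A.eHat` onto `ιX(K)`.  Bookkeeping. [claim: Mochizuki2012, status: disputed] -/
theorem StableCurveAgreement.map_subgroupOf_pmHat_eq_of_iff {W : PlusMinusTower T} {Cu : CuspidalInertiaData W}
    {D : StableCurveTemperedData.{u}} (A : StableCurveAgreement W Cu D) (φ : T.Xplain ≃ D.PiTp)
    (hA : ∀ w : T.Xplain, A.eHat ⟨W.emb w, W.emb_le_pmHat ⟨w, rfl⟩⟩ = D.ιX (φ w))
    {I₀ : Subgroup W.Corhat} (hI₀ : I₀ ≤ W.piPM) {K : Subgroup D.PiTp}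
    (h : ∀ w : T.Xplain, W.emb w ∈ I₀ ↔ φ w ∈ K) :
    (I₀.subgroupOf W.pmHat).map A.eHat.toMonoidHom = K.map D.ιX := by
  ext c
  constructor
  · rintro ⟨g, hg, rfl⟩
    have hg' : (g : W.Corhat) ∈ I₀ := Subgroup.mem_subgroupOf.mp hg
    obtain ⟨w, hw⟩ := hI₀ hg'
    have hgw : g = ⟨W.emb w, W.emb_le_pmHat ⟨w, rfl⟩⟩ := Subtype.ext hw.symm
    have hwI : W.emb w ∈ I₀ := by rw [hw]; exact hg'
    refine ⟨φ w, (h w).mp hwI, ?_⟩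
    change D.ιX (φ w) = A.eHat g
    rw [hgw, hA]
  · rintro ⟨k, hk, rfl⟩
    obtain ⟨w, rfl⟩ := φ.surjective k
    exact ⟨⟨W.emb w, W.emb_le_pmHat ⟨w, rfl⟩⟩, Subgroup.mem_subgroupOf.mpr ((h w).mpr hk), hA w⟩

/-- **IUTchII:Def2.3(ii)** (kurims p.68) Constructor at the level `Π_v`: a subgroup `I ≤ Π_v` whose `emb ∘ incl`-members are exactly the `z` with
`ψ z ∈ K` (`ψ` a bijection, `eV ∘ emb ∘ incl = ιX ∘ ψ`) is carried by `eV` onto `ιX(K)`.  Bookkeeping. [claim: Mochizuki2012, status: disputed] -/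
theorem map_subgroupOf_hat_eq_of_iff {W : PlusMinusTower T} {D : StableCurveTemperedData.{u}} (eV : W.hat ≃* D.PiHat)
    (ψ : P ≃ D.PiTp) (hV : ∀ z : P, eV ⟨W.emb (T.incl z), W.embP_le_hat ⟨z, rfl⟩⟩ = D.ιX (ψ z))
    {I : Subgroup W.Corhat} (hI : I ≤ W.piV) {K : Subgroup D.PiTp}
    (h : ∀ z : P, W.emb (T.incl z) ∈ I ↔ ψ z ∈ K) :
    (I.subgroupOf W.hat).map eV.toMonoidHom = K.map D.ιX := by
  ext c
  constructor
  · rintro ⟨g, hg, rfl⟩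
    have hg' : (g : W.Corhat) ∈ I := Subgroup.mem_subgroupOf.mp hg
    obtain ⟨z, hz⟩ := hI hg'
    have hgz : g = ⟨W.emb (T.incl z), W.embP_le_hat ⟨z, rfl⟩⟩ := Subtype.ext hz.symm
    have hzI : W.emb (T.incl z) ∈ I := by
      have : (W.emb.comp T.incl) z = W.emb (T.incl z) := rfl
      rw [← this, hz]; exact hg'
    refine ⟨ψ z, (h z).mp hzI, ?_⟩
    change D.ιX (ψ z) = eV g
    rw [hgz, hV]
  · rintro ⟨k, hk, rfl⟩
    obtain ⟨z, rfl⟩ := ψ.surjective k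
    exact ⟨⟨W.emb (T.incl z), W.embP_le_hat ⟨z, rfl⟩⟩, Subgroup.mem_subgroupOf.mpr ((h z).mpr hk), hV z⟩

end Generic

/-! ## Membership in a conjugate of an inertia group of an [IUTchI] §2 datum `ofSpecialFibre` -/

section SpecialFibre

variable {p : ℕ} [Fact p.Prime] (Y : TemperedCurve p) (d : Y.GroupLevelData)
  (Sf : SpecialFibreData (Y.toTemperedArithmeticGroup d)) (h36 : Sf.Gc.Prop36Hypotheses)
  (Sigma SigmaHat : Set ℕ) (hsub : Sigma ⊆ SigmaHat) (hne : Sigma.Nonempty)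
  (hprime : ∀ q ∈ SigmaHat, q.Prime) (hp : p ∉ Sigma) (TpH : Subgroup Sf.chart.G)
  (HatH : Subgroup (TemperedGraphGroupData.exists_completion_of_prop36 Sf.Gc h36 Sf.chart).choose)
  (hle : TpH.map (TemperedGraphGroupData.exists_completion_of_prop36 Sf.Gc h36 Sf.chart).choose_spec.choose.toMonoidHom ≤ HatH)
  (cuspMeetsH : {x : Y.Pt // Y.IsCusp x} → Prop)

/-- In a group, `a⁻¹ * b * a = 1 ↔ b = 1`. [folklore] -/
private theorem inv_mul_mul_eq_one_iff {G : Type*} [Group G] (a b : G) : a⁻¹ * b * a = 1 ↔ b = 1 := by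
  constructor
  · intro h
    calc b = a * (a⁻¹ * b * a) * a⁻¹ := by group
      _ = 1 := by rw [h]; group
  · rintro rfl; group

/-- **IUTchI §2 (kurims p.47), bookkeeping at abc-iut-L5's datum `ofSpecialFibre Y …`**: membership in the `s`-conjugate of the inertia group
`I_y = D_y ∩ Δ^temp` of a cusp `y` (read in `Π^tp = Π^temp_{Y}`): `w ∈ s I_y s⁻¹ ↔ s⁻¹ w s ∈ D_y ∧ aug w = 1`.
[claim: Mochizuki2012, status: disputed] -/
theorem mem_conj_inertiaTp_ofSpecialFibre_iff
    (y : (StableCurveTemperedData.ofSpecialFibre Y d Sf h36 Sigma SigmaHat hsub hne hprime hp TpH HatH hle cuspMeetsH).Cusp)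
    (s w : Y.PiTemp) :
    w ∈ MulAut.conj s •
        (((StableCurveTemperedData.ofSpecialFibre Y d Sf h36 Sigma SigmaHat hsub hne hprime hp TpH HatH hle cuspMeetsH).inertiaTp y).map
          (StableCurveTemperedData.ofSpecialFibre Y d Sf h36 Sigma SigmaHat hsub hne hprime hp TpH HatH hle cuspMeetsH).DeltaTp.subtype) ↔
      s⁻¹ * w * s ∈ Y.decomp y.1 ∧ Y.aug w = 1 := by
  rw [Subgroup.mem_pointwise_smul_iff_inv_smul_mem, MulAut.smul_def, MulAut.conj_inv_apply]
  constructor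
  · rintro ⟨u, hu, hus⟩
    -- `u ∈ I_y = (D_y ⊓ Ker aug).subgroupOf (Ker augGK)` unfolds definitionally to membership of `↑u` in `D_y ⊓ Ker aug`
    have hu' : ((u : _) : Y.PiTemp) ∈ Y.decomp y.1 ⊓ Y.aug.toMonoidHom.ker := hu
    have hus' : ((u : _) : Y.PiTemp) = s⁻¹ * w * s := hus
    rw [hus', Subgroup.mem_inf, MonoidHom.mem_ker] at hu'
    refine ⟨hu'.1, ?_⟩
    have h2 : Y.aug (s⁻¹ * w * s) = 1 := hu'.2
    rwa [map_mul, map_mul, map_inv, inv_mul_mul_eq_one_iff] at h2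
  · rintro ⟨hD, haug⟩
    have haug' : Y.aug (s⁻¹ * w * s) = 1 := by
      rw [map_mul, map_mul, map_inv, inv_mul_mul_eq_one_iff]; exact haug
    have hker : s⁻¹ * w * s ∈ Y.augGK.toMonoidHom.ker := by
      rw [StableCurveTemperedData.OfSpecialFibre.ker_augGK_eq_deltaTemp]
      exact haug'
    refine ⟨⟨s⁻¹ * w * s, hker⟩, ?_, rfl⟩
    change s⁻¹ * w * s ∈ Y.decomp y.1 ⊓ Y.aug.toMonoidHom.ker
    exact Subgroup.mem_inf.mpr ⟨hD, haug'⟩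

end SpecialFibre

/-! ## The `Π_v`-level dictionary at the genuine pair of curves `X̲_v`, `X̲̲_v` -/

section Dictionary

variable {p : ℕ} [Fact p.Prime] {M : MuTwoSetting p} (e : M.CLevelData)
  {E : M.toThetaSetting.EtaleThetaData} {l : ℕ} (C : E.DoubleUnderline l) {N : ℕ+}
  (μ : M.toThetaSetting.CyclotomeMod l N) (hC : M.toThetaSetting.Compat) (hS : M.toThetaSetting.Sec2Hyps)
  (hl : l.Prime) (hp2 : p ≠ 2) (hpl : p ≠ l) (hζ : ∃ ζ : M.toThetaSetting.K, IsPrimitiveRoot ζ (4 * l))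
  {η : (C.thetaEnvData μ hC hS).PiYdd → MuN p N} (hη : η ∈ (C.thetaEnvData μ hC hS).thetaCocycles)
  {P : TopGroup.{0}} {T : TemperedCoverings (BadPlaceSetting.ofUnderline C μ hC hS hl hp2 hpl hζ hη) P}
  (d : M.toTemperedCurve.GroupLevelData)
  -- special-fibre data of `X̲_v` (suffix `u`) …
  (Sfu : SpecialFibreData ((M.toThetaSetting.temperedCurveXuOfLevelData l C.l_ne_zero d).toTemperedArithmeticGroup
    (M.toThetaSetting.groupLevelDataXu l C.l_ne_zero d)))
  (h36u : Sfu.Gc.Prop36Hypotheses) (Sigmau SigmaHatu : Set ℕ) (hsubu : Sigmau ⊆ SigmaHatu) (hneu : Sigmau.Nonempty)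
  (hprimeu : ∀ q ∈ SigmaHatu, q.Prime) (hpu : p ∉ Sigmau) (TpHu : Subgroup Sfu.chart.G)
  (HatHu : Subgroup (TemperedGraphGroupData.exists_completion_of_prop36 Sfu.Gc h36u Sfu.chart).choose)
  (hleu : TpHu.map (TemperedGraphGroupData.exists_completion_of_prop36 Sfu.Gc h36u Sfu.chart).choose_spec.choose.toMonoidHom ≤ HatHu)
  (cuspu : {x : (M.toThetaSetting.temperedCurveXuOfLevelData l C.l_ne_zero d).Pt //
    (M.toThetaSetting.temperedCurveXuOfLevelData l C.l_ne_zero d).IsCusp x} → Prop)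
  -- … and of `X̲̲_v` (no suffix)
  (Sf : SpecialFibreData ((C.temperedCurveXuuOfLevelData C.l_ne_zero d).toTemperedArithmeticGroup
    (C.groupLevelDataXuu C.l_ne_zero d)))
  (h36 : Sf.Gc.Prop36Hypotheses) (Sigma SigmaHat : Set ℕ) (hsub : Sigma ⊆ SigmaHat) (hne : Sigma.Nonempty)
  (hprime : ∀ q ∈ SigmaHat, q.Prime) (hp : p ∉ Sigma) (TpH : Subgroup Sf.chart.G)
  (HatH : Subgroup (TemperedGraphGroupData.exists_completion_of_prop36 Sf.Gc h36 Sf.chart).choose)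
  (hle : TpH.map (TemperedGraphGroupData.exists_completion_of_prop36 Sf.Gc h36 Sf.chart).choose_spec.choose.toMonoidHom ≤ HatH)
  (cuspMeetsH : {x : (C.temperedCurveXuuOfLevelData C.l_ne_zero d).Pt //
    (C.temperedCurveXuuOfLevelData C.l_ne_zero d).IsCusp x} → Prop)

/-- **[IUTchII] Def 2.3 (ii) AT THE GENUINE MODEL — the cuspidal inertia groups of `Π_v` are the conjugates of the inertia groups of the
cusps of `X̲̲_v`.**  Let `W` be ANY `±`-tower over a Prop 2.1 output `T` of the print-level model `BadPlaceSetting.ofUnderline` (e.g. the tower of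
record `ofPiCHat`), `Cu` a cuspidal-inertia datum and `A : StableCurveAgreement W Cu Du` an agreement with abc-iut-L5's [IUTchI] §2 datum `Du` of
the curve `X̲_v` (abc-iut-L6-t7's `temperedCurveXuOfLevelData`) such that `A.eHat ∘ emb = toHat ∘ plainIso` (`hA`) and `Cu` is generated from its
`Π^±_v`-level family by intersection (`hlev` — print's recipe «the cuspidal inertia groups of `Π_⊆` may be obtained as the intersections with `Π_⊆`
of those cuspidal inertia groups of `Π_⊇`», Def 2.3 (ii) p. 68; both clauses are exactly what abc-iut-w5-d132's p433029 / p434636 deliver), and let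
`eV : Π̂_v ⥲ Π̂_{X̲̲_v}` be ANY identification with the datum `Duu` of `X̲̲_v` (abc-iut-L6-t7's `temperedCurveXuuOfLevelData`) such that
`eV ∘ emb ∘ incl = toHat ∘ refIso` (`heV` — clause (i) of `exists_isoV_ofPiCHat_ofSpecialFibreXuu`, p437742).  THEN for every subgroup `I`:
`I` is a cuspidal inertia group of `Π_v` (for `Cu`) iff `I ≤ Π_v` and `eV(I) = toHat(s · I_y · s⁻¹)` for some cusp `y` of `X̲̲_v` and some
`s ∈ Π^tp_{X̲̲_v}` — i.e. the `inertia_iff` clause of an agreement AT LEVEL `Π_v` holds for the SAME datum `Cu`.  PROOF: pure covering-theory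
bookkeeping in abc-iut-L3's double-coset description of the cusps of `X̲_v`, `X̲̲_v` over those of `X_v` (`TemperedCurve.ofOpenSubgroup`, p432410:
`I_y = H ∩ g I_x g⁻¹`): both families are `{Π^tp_{X̲̲_v} ∩ k I_x k⁻¹ : x a cusp of X_v, k ∈ Π^tp_{X_v}}` (`DoubleCoset.mk_out_eq_mul`; `I_x ⊆ D_x`).
No total-ramification input is needed for this dictionary (that input — Rmk 2.1.1 (i) — is what makes each cusp of `X̲_v` have exactly ONE
cusp of `X̲̲_v` above it, Rmk 2.3.1 `I ∩ Π_⊆ = I^l`; not used here).  ([IUTchII] Def 2.3 (ii), kurims p.68; [IUTchI] §2 p.47)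
[cite: Mochizuki2012, II Def 2.3 (ii) p.68] [cite: MochizukiSemiAnbd2006, §6 p.71] [claim: Mochizuki2012, status: disputed] -/
theorem isCuspidalInertia_piV_iff_cuspsXuu (W : PlusMinusTower T) (Cu : CuspidalInertiaData W)
    (A : StableCurveAgreement W Cu
      (StableCurveTemperedData.ofSpecialFibre (M.toThetaSetting.temperedCurveXuOfLevelData l C.l_ne_zero d)
        (M.toThetaSetting.groupLevelDataXu l C.l_ne_zero d) Sfu h36u Sigmau SigmaHatu hsubu hneu hprimeu hpu TpHu HatHu hleu cuspu))
    (hA : ∀ x : T.Xplain, A.eHat ⟨W.emb x, W.emb_le_pmHat ⟨x, rfl⟩⟩ =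
      (StableCurveTemperedData.ofSpecialFibre (M.toThetaSetting.temperedCurveXuOfLevelData l C.l_ne_zero d)
        (M.toThetaSetting.groupLevelDataXu l C.l_ne_zero d) Sfu h36u Sigmau SigmaHatu hsubu hneu hprimeu hpu TpHu HatHu hleu cuspu).ιX
        (T.plainIso x))
    (hlev : ∀ (Q I : Subgroup W.Corhat), Cu.IsCuspidalInertia Q I ↔
      I ≤ Q ∧ ∃ I₀ : Subgroup W.Corhat, Cu.IsCuspidalInertia W.piPM I₀ ∧ I = I₀ ⊓ Q)
    (eV : W.hat ≃* (StableCurveTemperedData.ofSpecialFibre (C.temperedCurveXuuOfLevelData C.l_ne_zero d)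
        (C.groupLevelDataXuu C.l_ne_zero d) Sf h36 Sigma SigmaHat hsub hne hprime hp TpH HatH hle cuspMeetsH).PiHat)
    (heV : ∀ z : P, eV ⟨W.emb (T.incl z), W.embP_le_hat ⟨z, rfl⟩⟩ =
      (StableCurveTemperedData.ofSpecialFibre (C.temperedCurveXuuOfLevelData C.l_ne_zero d)
        (C.groupLevelDataXuu C.l_ne_zero d) Sf h36 Sigma SigmaHat hsub hne hprime hp TpH HatH hle cuspMeetsH).ιX (T.refIso z))
    (I : Subgroup W.Corhat) :
    Cu.IsCuspidalInertia W.piV I ↔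
      I ≤ W.piV ∧ ∃ (y : (StableCurveTemperedData.ofSpecialFibre (C.temperedCurveXuuOfLevelData C.l_ne_zero d)
          (C.groupLevelDataXuu C.l_ne_zero d) Sf h36 Sigma SigmaHat hsub hne hprime hp TpH HatH hle cuspMeetsH).Cusp)
        (s : (StableCurveTemperedData.ofSpecialFibre (C.temperedCurveXuuOfLevelData C.l_ne_zero d)
          (C.groupLevelDataXuu C.l_ne_zero d) Sf h36 Sigma SigmaHat hsub hne hprime hp TpH HatH hle cuspMeetsH).PiTp),
        (I.subgroupOf W.hat).map eV.toMonoidHom =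
          (MulAut.conj s • ((StableCurveTemperedData.ofSpecialFibre (C.temperedCurveXuuOfLevelData C.l_ne_zero d)
              (C.groupLevelDataXuu C.l_ne_zero d) Sf h36 Sigma SigmaHat hsub hne hprime hp TpH HatH hle cuspMeetsH).inertiaTp y).map
            (StableCurveTemperedData.ofSpecialFibre (C.temperedCurveXuuOfLevelData C.l_ne_zero d)
              (C.groupLevelDataXuu C.l_ne_zero d) Sf h36 Sigma SigmaHat hsub hne hprime hp TpH HatH hle cuspMeetsH).DeltaTp.subtype).map
          (StableCurveTemperedData.ofSpecialFibre (C.temperedCurveXuuOfLevelData C.l_ne_zero d)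
            (C.groupLevelDataXuu C.l_ne_zero d) Sf h36 Sigma SigmaHat hsub hne hprime hp TpH HatH hle cuspMeetsH).ιX := by
  -- the base curve `X_v` (type `(1,1)`); `X̲_v` has `Π^tp = GtpXu l`, `X̲̲_v` has `Π^tp = Huu`, both via `TemperedCurve.ofOpenSubgroup`
  let X : TemperedCurve p := M.toTemperedCurve
  constructor
  · intro hI
    obtain ⟨hIle, I₀, hI₀, hIeq⟩ := (hlev _ _).mp hI
    obtain ⟨-, xu, t, hEqu⟩ := (A.inertia_iff I₀).mp hI₀
    -- `xu` is a cusp of `X̲_v` over the cusp `x := xu.1.1` of `X_v` with chosen representative `g := repOfOpen xu.1`; the cusp of `X̲̲_v`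
    -- we want is the double coset of `k := t·g`, whose chosen representative is `h·k·δ` (`h ∈ Π^tp_{X̲̲_v}`, `δ ∈ D_x`); take `s := h⁻¹`
    obtain ⟨h, δ, hh, hδ, hout⟩ := DoubleCoset.mk_out_eq_mul C.Huu (X.decomp xu.1.1)
      (t.1 * X.repOfOpen (M.GtpXu l) xu.1)
    refine ⟨hIle, ⟨⟨xu.1.1, DoubleCoset.mk C.Huu (X.decomp xu.1.1) (t.1 * X.repOfOpen (M.GtpXu l) xu.1)⟩, xu.2⟩,
      ⟨h⁻¹, C.Huu.inv_mem hh⟩, ?_⟩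
    refine map_subgroupOf_hat_eq_of_iff eV T.refIso.toEquiv heV hIle fun z => ?_
    rw [mem_conj_inertiaTp_ofSpecialFibre_iff, hIeq, Subgroup.mem_inf,
      A.emb_mem_iff_of_map_eq (fun x => T.plainIso x) hA hEqu (T.incl z), mem_conj_inertiaTp_ofSpecialFibre_iff,
      T.plainIso_incl]
    -- what is left is group theory in `Π^tp_X`: `(h k δ)⁻¹ (h ζ h⁻¹) (h k δ) ∈ D_x ↔ k⁻¹ ζ k ∈ D_x` (`δ ∈ D_x`)
    have hrep : X.repOfOpen C.Huu ⟨xu.1.1, DoubleCoset.mk C.Huu (X.decomp xu.1.1) (t.1 * X.repOfOpen (M.GtpXu l) xu.1)⟩ =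
        h * (t.1 * X.repOfOpen (M.GtpXu l) xu.1) * δ := hout
    have step : (X.repOfOpen (M.GtpXu l) xu.1)⁻¹ * (t.1⁻¹ * (T.refIso z).1 * t.1) * (X.repOfOpen (M.GtpXu l) xu.1)⁻¹⁻¹ ∈
          X.decomp xu.1.1 ↔
        (X.repOfOpen C.Huu ⟨xu.1.1, DoubleCoset.mk C.Huu (X.decomp xu.1.1) (t.1 * X.repOfOpen (M.GtpXu l) xu.1)⟩)⁻¹ *
            (h⁻¹⁻¹ * (T.refIso z).1 * h⁻¹) *
          (X.repOfOpen C.Huu ⟨xu.1.1, DoubleCoset.mk C.Huu (X.decomp xu.1.1) (t.1 * X.repOfOpen (M.GtpXu l) xu.1)⟩)⁻¹⁻¹ ∈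
          X.decomp xu.1.1 := by
      rw [hrep]
      have e1 : (h * (t.1 * X.repOfOpen (M.GtpXu l) xu.1) * δ)⁻¹ * (h⁻¹⁻¹ * (T.refIso z).1 * h⁻¹) *
            (h * (t.1 * X.repOfOpen (M.GtpXu l) xu.1) * δ)⁻¹⁻¹ =
          δ⁻¹ * ((X.repOfOpen (M.GtpXu l) xu.1)⁻¹ * (t.1⁻¹ * (T.refIso z).1 * t.1) * (X.repOfOpen (M.GtpXu l) xu.1)⁻¹⁻¹) * δ := by
        group
      rw [e1, Subgroup.mul_mem_cancel_right _ hδ, Subgroup.mul_mem_cancel_left _ ((X.decomp xu.1.1).inv_mem hδ)]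
    exact ⟨fun hh => ⟨step.mp hh.1.1, hh.1.2⟩, fun hh => ⟨⟨step.mpr hh.1, hh.2⟩, ⟨z, rfl⟩⟩⟩
  · rintro ⟨hIle, y, s, hEq⟩
    -- `y` is a cusp of `X̲̲_v` over the cusp `x := y.1.1` of `X_v` with chosen representative `g' := repOfOpen y.1`; the cusp of `X̲_v` we
    -- want is the double coset of `k := s·g'`, whose chosen representative is `hu·k·δu` (`hu ∈ Π^tp_{X̲_v}`, `δu ∈ D_x`); take `t := hu⁻¹`
    obtain ⟨hu, δu, hhu, hδu, houtu⟩ := DoubleCoset.mk_out_eq_mul (M.GtpXu l) (X.decomp y.1.1)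
      (s.1 * X.repOfOpen C.Huu y.1)
    let xu : (StableCurveTemperedData.ofSpecialFibre (M.toThetaSetting.temperedCurveXuOfLevelData l C.l_ne_zero d)
        (M.toThetaSetting.groupLevelDataXu l C.l_ne_zero d) Sfu h36u Sigmau SigmaHatu hsubu hneu hprimeu hpu TpHu HatHu hleu cuspu).Cusp :=
      ⟨⟨y.1.1, DoubleCoset.mk (M.GtpXu l) (X.decomp y.1.1) (s.1 * X.repOfOpen C.Huu y.1)⟩, y.2⟩
    let t : (StableCurveTemperedData.ofSpecialFibre (M.toThetaSetting.temperedCurveXuOfLevelData l C.l_ne_zero d)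
        (M.toThetaSetting.groupLevelDataXu l C.l_ne_zero d) Sfu h36u Sigmau SigmaHatu hsubu hneu hprimeu hpu TpHu HatHu hleu cuspu).PiTp :=
      ⟨hu⁻¹, (M.GtpXu l).inv_mem hhu⟩
    let I₀ : Subgroup W.Corhat :=
      ((MulAut.conj t • ((StableCurveTemperedData.ofSpecialFibre (M.toThetaSetting.temperedCurveXuOfLevelData l C.l_ne_zero d)
        (M.toThetaSetting.groupLevelDataXu l C.l_ne_zero d) Sfu h36u Sigmau SigmaHatu hsubu hneu hprimeu hpu TpHu HatHu hleu cuspu).inertiaTp xu).map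
          (StableCurveTemperedData.ofSpecialFibre (M.toThetaSetting.temperedCurveXuOfLevelData l C.l_ne_zero d)
        (M.toThetaSetting.groupLevelDataXu l C.l_ne_zero d) Sfu h36u Sigmau SigmaHatu hsubu hneu hprimeu hpu TpHu HatHu hleu cuspu).DeltaTp.subtype).map
        T.plainIso.symm.toMulEquiv.toMonoidHom).map W.emb
    -- `plainIso` read with values in `Π^tp_{X̲_v}` as typed by the datum (same map; keeps memberships well-typed for rewriting)
    let φu : T.Xplain ≃ (StableCurveTemperedData.ofSpecialFibre (M.toThetaSetting.temperedCurveXuOfLevelData l C.l_ne_zero d)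
        (M.toThetaSetting.groupLevelDataXu l C.l_ne_zero d) Sfu h36u Sigmau SigmaHatu hsubu hneu hprimeu hpu TpHu HatHu hleu cuspu).PiTp :=
      T.plainIso.toEquiv
    -- membership in `I₀` of `emb w`
    have hmemI₀ : ∀ w : T.Xplain, W.emb w ∈ I₀ ↔
        φu w ∈ MulAut.conj t • ((StableCurveTemperedData.ofSpecialFibre (M.toThetaSetting.temperedCurveXuOfLevelData l C.l_ne_zero d)
        (M.toThetaSetting.groupLevelDataXu l C.l_ne_zero d) Sfu h36u Sigmau SigmaHatu hsubu hneu hprimeu hpu TpHu HatHu hleu cuspu).inertiaTp xu).map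
          (StableCurveTemperedData.ofSpecialFibre (M.toThetaSetting.temperedCurveXuOfLevelData l C.l_ne_zero d)
        (M.toThetaSetting.groupLevelDataXu l C.l_ne_zero d) Sfu h36u Sigmau SigmaHatu hsubu hneu hprimeu hpu TpHu HatHu hleu cuspu).DeltaTp.subtype := by
      intro w
      constructor
      · rintro ⟨w', ⟨k', hk', rfl⟩, hww⟩
        have hw' : T.plainIso.symm k' = w := W.emb_injective hww
        have hk'' : φu (T.plainIso.symm k') = k' := T.plainIso.apply_symm_apply k'
        rw [← hw', hk'']
        exact hk'
      · intro hw
        exact ⟨T.plainIso.symm (φu w), ⟨φu w, hw, rfl⟩, congrArg W.emb (T.plainIso.symm_apply_apply w)⟩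
    -- the chosen representative of the cusp `xu` of `X̲_v`
    have hrepu : X.repOfOpen (M.GtpXu l) xu.1 = hu * (s.1 * X.repOfOpen C.Huu y.1) * δu := houtu
    -- the two membership criteria agree on `Π_v`
    have key : ∀ z : P, W.emb (T.incl z) ∈ I₀ ↔ W.emb (T.incl z) ∈ I := by
      intro z
      -- `plainIso (incl z) = inclPlain (refIso z)`: the same element of `Π^tp_X` as `refIso z`
      have hφ : φu (T.incl z) = (BadPlaceSetting.ofUnderline C μ hC hS hl hp2 hpl hζ hη).inclPlain (T.refIso z) :=
        T.plainIso_incl z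
      rw [hmemI₀, emb_incl_mem_iff_of_map_eq eV (fun z => T.refIso z) heV hEq z, mem_conj_inertiaTp_ofSpecialFibre_iff,
        mem_conj_inertiaTp_ofSpecialFibre_iff, hφ]
      have step : (X.repOfOpen (M.GtpXu l) xu.1)⁻¹ * (t.1⁻¹ * (T.refIso z).1 * t.1) * (X.repOfOpen (M.GtpXu l) xu.1)⁻¹⁻¹ ∈
            X.decomp y.1.1 ↔
          (X.repOfOpen C.Huu y.1)⁻¹ * (s.1⁻¹ * (T.refIso z).1 * s.1) * (X.repOfOpen C.Huu y.1)⁻¹⁻¹ ∈ X.decomp y.1.1 := by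
        rw [hrepu]
        have e1 : (hu * (s.1 * X.repOfOpen C.Huu y.1) * δu)⁻¹ * ((hu⁻¹)⁻¹ * (T.refIso z).1 * hu⁻¹) *
              (hu * (s.1 * X.repOfOpen C.Huu y.1) * δu)⁻¹⁻¹ =
            δu⁻¹ * ((X.repOfOpen C.Huu y.1)⁻¹ * (s.1⁻¹ * (T.refIso z).1 * s.1) * (X.repOfOpen C.Huu y.1)⁻¹⁻¹) * δu := by
          group
        change (hu * (s.1 * X.repOfOpen C.Huu y.1) * δu)⁻¹ * ((hu⁻¹)⁻¹ * (T.refIso z).1 * hu⁻¹) *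
            (hu * (s.1 * X.repOfOpen C.Huu y.1) * δu)⁻¹⁻¹ ∈ X.decomp y.1.1 ↔ _
        rw [e1, Subgroup.mul_mem_cancel_right _ hδu, Subgroup.mul_mem_cancel_left _ ((X.decomp y.1.1).inv_mem hδu)]
      exact ⟨fun hh => ⟨step.mp hh.1, hh.2⟩, fun hh => ⟨step.mpr hh.1, hh.2⟩⟩
    apply (hlev _ _).mpr
    refine ⟨hIle, I₀, ?_, ?_⟩
    · -- `I₀` is a cuspidal inertia group of `Π^±_v`: the agreement's `inertia_iff` with the cusp `xu` of `X̲_v` and `t = hu⁻¹`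
      apply (A.inertia_iff I₀).mpr
      have hI₀le : I₀ ≤ W.piPM := by
        rintro _ ⟨w, -, rfl⟩
        exact ⟨w, rfl⟩
      exact ⟨hI₀le, xu, t, A.map_subgroupOf_pmHat_eq_of_iff T.plainIso.toEquiv hA hI₀le hmemI₀⟩
    · -- `I = I₀ ∩ Π_v`
      ext c
      constructor
      · intro hc
        obtain ⟨z, rfl⟩ := hIle hc
        exact ⟨(key z).mpr hc, ⟨z, rfl⟩⟩
      · rintro ⟨hc₀, ⟨z, rfl⟩⟩
        exact (key z).mp hc₀

end Dictionary

end PlusMinusTower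

end Literature.IUT.HodgeArakelov

end
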